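import Literature.RingTheory.KTheory.KZeroRing
import Literature.AlgebraicTopology.KTheory.Basic
import HarnessLib

/-!
# The ring `K⁰(X)` and the external product `K⁰(X) ⊗ K⁰(Y) → K⁰(X × Y)`

`K⁰(X) = K₀(C(X, ℂ))` is a commutative ring (tensor product of idempotents,
`Literature/RingTheory/KTheory/KZeroRing.lean`; Husemöller et al., Ch. 4 Def. 2.3: `K(X)` is the
ring localisation of the semiring `Vect/X`), pull-backs `f^*` and ranks `rank_x` are ring
homomorphisms (Ch. 4 Rem. 2.4–2.6), and the **external product** (external `K`-cup product,
Husemöller, *Fibre Bundles*, Ch. 11 §1) is `a ⊠ b = pr₁^* a · pr₂^* b ∈ K⁰(X × Y)`: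

* `pullback_const` (pull-back along a constant map is `rank • [1]`), `pullback_unitHom`,
  `Idem.map_map`, `KZero.of_unit_eq_unitHom`;
* `instCommRingK0`, `pullbackRingHom`, `pullback_mul/one`, `rankAtRingHom`, `rankAt_mul/one`,
  `mul_mem_reduced` (`K̃⁰` is an ideal);
* `extProd` (notation `⊠`), `extProd_of_of` (`[p] ⊠ [q] = [pr₁^* p ⊗ pr₂^* q]`), biadditivity,
  `mul_extProd_mul`, `one_extProd`, `extProd_one`, naturality `pullback_prodMap_extProd`, the
  slices `pullback_sliceLeft/Right_extProd` (`(x ↦ (x, y))^* (a ⊠ b) = rank_y(b) a`),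
  `rankAt_extProd`, `extProd_mem_reduced`.

Everything is proved; no named facts.

## References

* D. Husemöller, M. Joachim, B. Jurčo, M. Schottenloher, *Basic Bundle Theory and K-Cohomology
  Invariants*, LNP 726 (2008) [HusemollerEtAl2008]: Ch. 4 Def. 2.3, Rem. 2.4–2.6, Def. 4.1.
* D. Husemöller, *Fibre Bundles*, 3rd ed. (1994) [HusemollerFibreBundles1994]: Ch. 11 §1 (the
  external `K`-cup product `K(X) ⊗ K(S²) → K(X × S²)`).

## Design notes

* The external product is stated on `K0 X × K0 Y` (biadditive) rather than on the tensor product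
  of abelian groups; the Bott periodicity theorem will be stated as "`K⁰(X × S²)` is free over
  `K⁰(X)` on `1, H`", which needs no `TensorProduct`.
* `instCommRingK0` re-keys the ring instance of `KZeroRing.lean` on `K0 X` (see its docstring);
  it is definitionally that instance.
-/

noncomputable section

namespace Literature.AlgebraicTopology.KTheory

open Literature.RingTheory.KTheory Matrix

universe u v w

variable {X : Type u} {Y : Type v} {Z : Type w}
  [TopologicalSpace X] [TopologicalSpace Y] [TopologicalSpace Z]

/-! ### Constant idempotent families and pull-back along constant maps -/

/-- `Idem.map` is functorial: `(p.map f).map g = p.map (g ∘ f)`. [folklore] -/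
theorem _root_.Literature.RingTheory.KTheory.Idem.map_map {R S T : Type*} [Ring R] [Ring S] [Ring T]
    (f : R →+* S) (g : S →+* T) (p : Idem R) : (p.map f).map g = p.map (g.comp f) := rfl

/-- The inclusion of constants `ℂ → C(X, ℂ)` as a ring homomorphism. [folklore] -/
def constRingHom (X : Type u) [TopologicalSpace X] : ℂ →+* C(X, ℂ) := (algebraMap ℂ C(X, ℂ))

/-- Values of a constant function. [folklore] -/
@[simp] theorem constRingHom_apply_apply (c : ℂ) (x : X) : constRingHom X c x = c := rfl

/-- Pull-back along a constant map is `const ∘ eval`. [folklore] -/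
theorem comapRingHom_const {Y : Type*} [TopologicalSpace Y] (y : Y) :
    comapRingHom (ContinuousMap.const X y) = (constRingHom X).comp (evalRingHom y) :=
  RingHom.ext fun _ ↦ ContinuousMap.ext fun _ ↦ rfl

/-- A constant idempotent family has the class of the free module of its rank:
`[c] = rank(c) • [1]`. [folklore] -/
theorem of_map_constRingHom (e : Idem ℂ) :
    KZero.of (e.map (constRingHom X)) = KZero.of (Idem.unit e.rank : Idem C(X, ℂ)) := by
  have h : e ≈ Idem.unit e.rank := e.equiv_unit_rank
  have := AlgEquivalent.map (constRingHom X) (Idem.equiv_iff.1 h)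
  rw [← Idem.map_unit (constRingHom X)]
  exact KZero.of_eq_of this

/-- `[1ₙ] = unitHom n`. [folklore] -/
theorem _root_.Literature.RingTheory.KTheory.KZero.of_unit_eq_unitHom {R : Type*} [Ring R] (n : ℕ) :
    KZero.of (Idem.unit n : Idem R) = KZero.unitHom R n := by
  rw [KZero.unitHom_apply, natCast_zsmul, KZero.of_unit]

/-- **Pull-back along a constant map** is `rank • [1]`: `(const y)^* b = rank_y(b) • [1]`.
[folklore] -/
theorem pullback_const {Y : Type*} [TopologicalSpace Y] (y : Y) (b : K0 Y) :
    pullback (ContinuousMap.const X y) b = KZero.unitHom C(X, ℂ) (rankAt y b) := by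
  obtain ⟨p, q, rfl⟩ := KZero.exists_of_sub_of b
  simp only [map_sub, pullback_of, rankAt_of]
  rw [comapRingHom_const, ← Idem.map_map, ← Idem.map_map, of_map_constRingHom, of_map_constRingHom,
    KZero.of_unit_eq_unitHom, KZero.of_unit_eq_unitHom]

/-- Pull-back fixes the multiples of `[1]`. [folklore] -/
theorem pullback_unitHom {Y : Type*} [TopologicalSpace Y] (f : C(X, Y)) (k : ℤ) :
    pullback f (KZero.unitHom C(Y, ℂ) k) = KZero.unitHom C(X, ℂ) k := by
  rw [KZero.unitHom_apply, map_zsmul, pullback_of, Idem.map_unit, KZero.unitHom_apply]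

/-! ### `K⁰(X)` is a commutative ring; pull-backs are ring homomorphisms -/

variable (X) in
/-- **`K⁰(X)` is a commutative ring** (tensor product of idempotents, `KZeroRing.lean`; Husemöller
et al., Ch. 4 Def. 2.3/4.3). The instance is re-keyed on `K0 X = KZero C(X, ℂ)` so that typeclass
search does not have to unify the two ring structures on `C(X, ℂ)` through `KZero ?R` (which
fails in nested searches, e.g. for `K0 (X × Y)`); it is definitionally the instance of
`KZeroRing.lean`, nothing is overridden. -/
instance instCommRingK0 : CommRing (K0 X) := inferInstanceAs (CommRing (KZero C(X, ℂ)))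

/-- **`f^*` is a ring homomorphism** `K⁰(Y) →+* K⁰(X)` (Husemöller et al., Ch. 4 Rem. 2.4:
`K : (top) → (c\rg)^{op}`). [cite: HusemollerEtAl2008, Ch. 4 Rem. 2.4] -/
def pullbackRingHom (f : C(X, Y)) : K0 Y →+* K0 X := KZero.mapRingHom (comapRingHom f)

/-- `pullbackRingHom f` is `pullback f` as a function. [cite: HusemollerEtAl2008, Ch. 4 Rem. 2.4] -/
@[simp] theorem pullbackRingHom_apply (f : C(X, Y)) (a : K0 Y) : pullbackRingHom f a = pullback f a := rfl

/-- `f^* (a b) = f^* a · f^* b`. [cite: HusemollerEtAl2008, Ch. 4 Rem. 2.4] -/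
theorem pullback_mul (f : C(X, Y)) (a b : K0 Y) : pullback f (a * b) = pullback f a * pullback f b :=
  map_mul (pullbackRingHom f) a b

/-- `f^* 1 = 1`. [cite: HusemollerEtAl2008, Ch. 4 Rem. 2.5] -/
theorem pullback_one (f : C(X, Y)) : pullback f (1 : K0 Y) = 1 := map_one (pullbackRingHom f)

/-- The rank at a point is a ring homomorphism `K⁰(X) →+* ℤ`. [cite: HusemollerEtAl2008, Ch. 4 Rem. 2.6] -/
def rankAtRingHom (x : X) : K0 X →+* ℤ :=
  (KZero.rankRingEquiv (K := ℂ)).toRingHom.comp (KZero.mapRingHom (evalRingHom x))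

/-- `rankAtRingHom x` is `rankAt x` as a function. [cite: HusemollerEtAl2008, Ch. 4 Rem. 2.6] -/
@[simp] theorem rankAtRingHom_apply (x : X) (a : K0 X) : rankAtRingHom x a = rankAt x a := rfl

/-- `rank_x (a b) = rank_x a · rank_x b`. [cite: HusemollerEtAl2008, Ch. 4 Rem. 2.6] -/
theorem rankAt_mul (x : X) (a b : K0 X) : rankAt x (a * b) = rankAt x a * rankAt x b :=
  map_mul (rankAtRingHom x) a b

/-- `rank_x 1 = 1`. [cite: HusemollerEtAl2008, Ch. 4 Rem. 2.5] -/
theorem rankAt_one (x : X) : rankAt x (1 : K0 X) = 1 := map_one (rankAtRingHom x)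

/-- `unitHom n = n` in the ring `K⁰(X)`. [folklore] -/
theorem unitHom_eq_intCast (n : ℤ) : KZero.unitHom C(X, ℂ) n = (n : K0 X) := KZero.unitHom_eq_intCast n

/-- The reduced group `K̃⁰(X, x₀)` is an ideal: closed under multiplication by `K⁰(X)`.
[cite: HusemollerEtAl2008, Ch. 4 Rem. 2.6] -/
theorem mul_mem_reduced {x₀ : X} (a : K0 X) {b : K0 X} (hb : b ∈ Reduced X x₀) : a * b ∈ Reduced X x₀ := by
  rw [mem_reduced_iff] at hb ⊢
  rw [rankAt_mul, hb, mul_zero]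

/-! ### The external product -/

/-- **The external product** `a ⊠ b = pr₁^* a · pr₂^* b ∈ K⁰(X × Y)` ("external `K`-cup product",
Husemöller, *Fibre Bundles*, Ch. 11 §1 / Ch. 9; Husemöller et al. Ch. 4 §2).
[cite: HusemollerFibreBundles1994, Ch. 11 §1] -/
def extProd (a : K0 X) (b : K0 Y) : K0 (X × Y) :=
  pullback ContinuousMap.fst a * pullback ContinuousMap.snd b

@[inherit_doc] scoped infixl:70 " ⊠ " => extProd

/-- Unfolding of `⊠`. [cite: HusemollerFibreBundles1994, Ch. 11 §1] -/
theorem extProd_def (a : K0 X) (b : K0 Y) :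
    a ⊠ b = pullback ContinuousMap.fst a * pullback ContinuousMap.snd b := rfl

/-- The external product on classes of idempotents is the class of the tensor product of the
pulled-back families: `[p] ⊠ [q] = [pr₁^* p ⊗ pr₂^* q]`. [cite: HusemollerFibreBundles1994, Ch. 11 §1] -/
theorem extProd_of_of (p : Idem C(X, ℂ)) (q : Idem C(Y, ℂ)) :
    KZero.of p ⊠ KZero.of q =
      KZero.of (p.map (comapRingHom ContinuousMap.fst) * q.map (comapRingHom ContinuousMap.snd)) := by
  rw [extProd_def, pullback_of, pullback_of, KZero.of_mul_of]

/-- `⊠` is biadditive (left). [cite: HusemollerFibreBundles1994, Ch. 11 §1] -/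
theorem add_extProd (a a' : K0 X) (b : K0 Y) : (a + a') ⊠ b = a ⊠ b + a' ⊠ b := by
  rw [extProd_def, extProd_def, extProd_def, map_add, add_mul]

/-- `⊠` is biadditive (right). [cite: HusemollerFibreBundles1994, Ch. 11 §1] -/
theorem extProd_add (a : K0 X) (b b' : K0 Y) : a ⊠ (b + b') = a ⊠ b + a ⊠ b' := by
  rw [extProd_def, extProd_def, extProd_def, map_add, mul_add]

/-- `⊠` commutes with subtraction (left). [cite: HusemollerFibreBundles1994, Ch. 11 §1] -/
theorem sub_extProd (a a' : K0 X) (b : K0 Y) : (a - a') ⊠ b = a ⊠ b - a' ⊠ b := by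
  rw [extProd_def, extProd_def, extProd_def, map_sub, sub_mul]

/-- `⊠` commutes with subtraction (right). [cite: HusemollerFibreBundles1994, Ch. 11 §1] -/
theorem extProd_sub (a : K0 X) (b b' : K0 Y) : a ⊠ (b - b') = a ⊠ b - a ⊠ b' := by
  rw [extProd_def, extProd_def, extProd_def, map_sub, mul_sub]

/-- `0 ⊠ b = 0`. [cite: HusemollerFibreBundles1994, Ch. 11 §1] -/
theorem zero_extProd (b : K0 Y) : (0 : K0 X) ⊠ b = 0 := by rw [extProd_def, map_zero, zero_mul]

/-- `a ⊠ 0 = 0`. [cite: HusemollerFibreBundles1994, Ch. 11 §1] -/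
theorem extProd_zero (a : K0 X) : a ⊠ (0 : K0 Y) = 0 := by rw [extProd_def, map_zero, mul_zero]

/-- `1 ⊠ b = pr₂^* b`. [cite: HusemollerFibreBundles1994, Ch. 11 §1] -/
theorem one_extProd (b : K0 Y) : (1 : K0 X) ⊠ b = pullback ContinuousMap.snd b := by
  rw [extProd_def, pullback_one, one_mul]

/-- `a ⊠ 1 = pr₁^* a`. [cite: HusemollerFibreBundles1994, Ch. 11 §1] -/
theorem extProd_one (a : K0 X) : a ⊠ (1 : K0 Y) = pullback ContinuousMap.fst a := by
  rw [extProd_def, pullback_one, mul_one]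

/-- `⊠` is multiplicative in each variable: `(a a') ⊠ (b b') = (a ⊠ b)(a' ⊠ b')`.
[cite: HusemollerFibreBundles1994, Ch. 11 §1] -/
theorem mul_extProd_mul (a a' : K0 X) (b b' : K0 Y) : (a * a') ⊠ (b * b') = (a ⊠ b) * (a' ⊠ b') := by
  simp only [extProd_def, pullback_mul]; ring

/-- **Naturality** of the external product: `(f × g)^* (a ⊠ b) = f^* a ⊠ g^* b`.
[cite: HusemollerFibreBundles1994, Ch. 11 §1] -/
theorem pullback_prodMap_extProd {X' : Type*} {Y' : Type*} [TopologicalSpace X'] [TopologicalSpace Y']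
    (f : C(X', X)) (g : C(Y', Y)) (a : K0 X) (b : K0 Y) :
    pullback (f.prodMap g) (a ⊠ b) = pullback f a ⊠ pullback g b := by
  have h1 : ContinuousMap.fst.comp (f.prodMap g) = f.comp ContinuousMap.fst := by ext; rfl
  have h2 : ContinuousMap.snd.comp (f.prodMap g) = g.comp ContinuousMap.snd := by ext; rfl
  rw [extProd_def, extProd_def, pullback_mul, ← AddMonoidHom.comp_apply, ← pullback_comp,
    ← AddMonoidHom.comp_apply, ← pullback_comp, h1, h2, pullback_comp, pullback_comp,
    AddMonoidHom.comp_apply, AddMonoidHom.comp_apply]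

/-- Restriction of `a ⊠ b` to a slice `X × {y}`: `(x ↦ (x, y))^* (a ⊠ b) = rank_y(b) • a`.
[cite: HusemollerFibreBundles1994, Ch. 11 §1] -/
theorem pullback_sliceLeft_extProd (y : Y) (a : K0 X) (b : K0 Y) :
    pullback ((ContinuousMap.id X).prodMk (ContinuousMap.const X y)) (a ⊠ b) = rankAt y b • a := by
  rw [extProd_def, pullback_mul, ← AddMonoidHom.comp_apply, ← pullback_comp, ← AddMonoidHom.comp_apply,
    ← pullback_comp]
  have h1 : ContinuousMap.fst.comp ((ContinuousMap.id X).prodMk (ContinuousMap.const X y)) = ContinuousMap.id X := by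
    ext; rfl
  have h2 : ContinuousMap.snd.comp ((ContinuousMap.id X).prodMk (ContinuousMap.const X y)) = ContinuousMap.const X y := by
    ext; rfl
  rw [h1, h2, pullback_id, AddMonoidHom.id_apply, pullback_const, unitHom_eq_intCast, zsmul_eq_mul, mul_comm]

/-- Restriction of `a ⊠ b` to a slice `{x} × Y`: `(y ↦ (x, y))^* (a ⊠ b) = rank_x(a) • b`.
[cite: HusemollerFibreBundles1994, Ch. 11 §1] -/
theorem pullback_sliceRight_extProd (x : X) (a : K0 X) (b : K0 Y) :
    pullback ((ContinuousMap.const Y x).prodMk (ContinuousMap.id Y)) (a ⊠ b) = rankAt x a • b := by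
  rw [extProd_def, pullback_mul, ← AddMonoidHom.comp_apply, ← pullback_comp, ← AddMonoidHom.comp_apply,
    ← pullback_comp]
  have h1 : ContinuousMap.fst.comp ((ContinuousMap.const Y x).prodMk (ContinuousMap.id Y)) = ContinuousMap.const Y x := by
    ext; rfl
  have h2 : ContinuousMap.snd.comp ((ContinuousMap.const Y x).prodMk (ContinuousMap.id Y)) = ContinuousMap.id Y := by
    ext; rfl
  rw [h1, h2, pullback_id, AddMonoidHom.id_apply, pullback_const, unitHom_eq_intCast, zsmul_eq_mul]

/-- Ranks multiply: `rank_{(x,y)} (a ⊠ b) = rank_x a · rank_y b`. [cite: HusemollerFibreBundles1994, Ch. 11 §1] -/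
theorem rankAt_extProd (x : X) (y : Y) (a : K0 X) (b : K0 Y) :
    rankAt (x, y) (a ⊠ b) = rankAt x a * rankAt y b := by
  rw [extProd_def, rankAt_mul, rankAt_pullback, rankAt_pullback]; rfl

/-- External products of reduced elements are reduced on both slices through the base points.
[cite: HusemollerFibreBundles1994, Ch. 11 §1] -/
theorem extProd_mem_reduced {x₀ : X} {y₀ : Y} {a : K0 X} {b : K0 Y} (ha : a ∈ Reduced X x₀) :
    a ⊠ b ∈ Reduced (X × Y) (x₀, y₀) := by
  rw [mem_reduced_iff, rankAt_extProd, mem_reduced_iff.1 ha, zero_mul]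

end Literature.AlgebraicTopology.KTheory

end
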